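import Literature.Computability.MetaComplexity.OrderingPrinciple
import Literature.Computability.MetaComplexity.DLOParitySystems
import HarnessLib

/-!
# The dense linear ordering principle `DLO_n`: clauses, proper assignments, rankings with witnesses (GOR 2024, §3.1.3)

The CNF `DLO_n` (`dloCNF n`) says that a linear order on `[n]` is dense [Gryaznov–Ovcharov–Riazanov
2024, §3.1.3; Gryaznov 2019, §3.3; after Urquhart and Riis]: variables `x_{ij}` (`ordVar n i j`,
`i ≠ j`) and `z_{ikj}` (`zVar n (i, k, j)`, "`k` witnesses `i ≺ j`", `i, k, j` pairwise distinct),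
clauses

1.–3. anti-symmetry, totality, transitivity (`ORDER_n`, `OrderingPrinciple.lean`),
4. witness semantics `¬z_{ikj} ∨ x_{ik}`, `¬z_{ikj} ∨ x_{kj}`,
5. density `D_{ij} = ¬x_{ij} ∨ ⋁_{k ≠ i, j} z_{ikj}` (`i ≠ j`).

`WORDER_n` (`worderClauses n`) is the set of clauses of types 1–4. This file is the dictionary
between `WORDER_n`-proper assignments and pairs (ranking injective on `range n`, proper witness set
of triples) of `DLOParitySystems.lean`: a proper `σ` is the assignment of its ranking `rankOf n σ` and
its witness set `witSet n σ` (`dloAssign_self`), every such pair gives a proper assignment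
(`isFProper_dloAssign`).

## References

* S. Gryaznov, S. Ovcharov, A. Riazanov, ACM Trans. Comput. Theory 16(3) (2024) = arXiv:2404.08370,
  §3.1.3 [GryaznovOvcharovRiazanov2024].
* S. Gryaznov, CSR 2019, LNCS 11532, §3.3 [Gryaznov2019].
-/

namespace Literature.Computability.MetaComplexity

open _root_.Computability Complexity Finset OrderParity

/-! ### Variables and clauses of `DLO_n` -/

/-- The variable `z_{ikj}` of `DLO_n` for the triple `τ = (i, k, j)` ("`k` witnesses `i ≺ j`"),
numbered `n² + (i·n + k)·n + j`. [Gryaznov–Ovcharov–Riazanov 2024, §3.1.3]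
[cite: GryaznovOvcharovRiazanov2024, §3.1.3] -/
def zVar (n : ℕ) (τ : ℕ × ℕ × ℕ) : ℕ :=
  n * n + ordVar n (ordVar n τ.1 τ.2.1) τ.2.2

/-- The witness clauses `¬z_{ikj} ∨ x_{ik}` and `¬z_{ikj} ∨ x_{kj}` (`i, k, j` pairwise distinct).
[Gryaznov–Ovcharov–Riazanov 2024, §3.1.3 ("Semantics for `z`'s")]
[cite: GryaznovOvcharovRiazanov2024, §3.1.3] -/
def witnessClauseList (n : ℕ) : List (Clause ℕ) :=
  (distinctTriples n).flatMap fun τ =>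
    [[(zVar n τ, false), (ordVar n τ.1 τ.2.1, true)], [(zVar n τ, false), (ordVar n τ.2.1 τ.2.2, true)]]

/-- The list `WORDER_n`: linear-order clauses and witness clauses (types 1–4).
[Gryaznov–Ovcharov–Riazanov 2024, §3.1.3 ("we define `WORDER_n` …")]
[cite: GryaznovOvcharovRiazanov2024, §3.1.3] -/
def worderClauseList (n : ℕ) : List (Clause ℕ) :=
  linOrderClauseList n ++ witnessClauseList n

/-- The set `WORDER_n`, the "`F`" of extensibility for `DLO_n`. [Gryaznov–Ovcharov–Riazanov 2024,
§3.1.3] [cite: GryaznovOvcharovRiazanov2024, §3.1.3] -/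
def worderClauses (n : ℕ) : Set (Clause ℕ) :=
  {c | c ∈ worderClauseList n}

/-- The density clause `D_{st} = ¬x_{st} ∨ ⋁_{k ≠ s, t} z_{skt}`. [Gryaznov–Ovcharov–Riazanov 2024,
§3.1.3 ("Density")] [cite: GryaznovOvcharovRiazanov2024, §3.1.3] -/
def densityClause (n s t : ℕ) : Clause ℕ :=
  (ordVar n s t, false) ::
    (((List.range n).filter fun k => k ≠ s ∧ k ≠ t).map fun k => (zVar n (s, k, t), true))

/-- **`DLO_n`** [Gryaznov–Ovcharov–Riazanov 2024, §3.1.3]: `WORDER_n` followed by the density clauses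
`D_{st}`, `s ≠ t`. [cite: GryaznovOvcharovRiazanov2024, §3.1.3] -/
def dloCNF (n : ℕ) : CNF ℕ :=
  worderClauseList n ++ (distinctPairs n).map fun p => densityClause n p.1 p.2

/-! ### Membership -/

/-- The clauses of `WORDER_n`: an `ORDER_n` clause or a witness clause. [Gryaznov–Ovcharov–Riazanov
2024, §3.1.3] [cite: GryaznovOvcharovRiazanov2024, §3.1.3] -/
theorem mem_worderClauses_iff {n : ℕ} {c : Clause ℕ} :
    c ∈ worderClauses n ↔ c ∈ linOrderClauses n ∨ ∃ τ ∈ distinctTriples n,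
      c = [(zVar n τ, false), (ordVar n τ.1 τ.2.1, true)] ∨
        c = [(zVar n τ, false), (ordVar n τ.2.1 τ.2.2, true)] := by
  unfold worderClauses worderClauseList witnessClauseList linOrderClauses
  simp only [Set.mem_setOf_eq, List.mem_append, List.mem_flatMap, List.mem_cons, List.not_mem_nil,
    or_false]

/-- `ORDER_n ⊆ WORDER_n`. [Gryaznov–Ovcharov–Riazanov 2024, §3.1.3] [cite: GryaznovOvcharovRiazanov2024, §3.1.3] -/
theorem mem_worderClauses_of_mem_linOrderClauses {n : ℕ} {c : Clause ℕ} (hc : c ∈ linOrderClauses n) :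
    c ∈ worderClauses n :=
  mem_worderClauses_iff.2 (Or.inl hc)

/-- The clauses of `DLO_n`: `WORDER_n` or a density clause. [Gryaznov–Ovcharov–Riazanov 2024, §3.1.3]
[cite: GryaznovOvcharovRiazanov2024, §3.1.3] -/
theorem mem_dloCNF_iff {n : ℕ} {c : Clause ℕ} :
    c ∈ dloCNF n ↔ c ∈ worderClauses n ∨ ∃ s t, s < n ∧ t < n ∧ s ≠ t ∧ c = densityClause n s t := by
  unfold dloCNF worderClauses
  simp only [List.mem_append, List.mem_map, Set.mem_setOf_eq]
  constructor
  · rintro (h | ⟨⟨s, t⟩, hp, rfl⟩)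
    · exact Or.inl h
    · obtain ⟨hs, ht, hst⟩ := mem_distinctPairs.1 hp
      exact Or.inr ⟨s, t, hs, ht, hst, rfl⟩
  · rintro (h | ⟨s, t, hs, ht, hst, rfl⟩)
    · exact Or.inl h
    · exact Or.inr ⟨(s, t), mem_distinctPairs.2 ⟨hs, ht, hst⟩, rfl⟩

/-- Density clauses are clauses of `DLO_n`. [Gryaznov–Ovcharov–Riazanov 2024, §3.1.3]
[cite: GryaznovOvcharovRiazanov2024, §3.1.3] -/
theorem densityClause_mem_dloCNF {n s t : ℕ} (hs : s < n) (ht : t < n) (hst : s ≠ t) :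
    densityClause n s t ∈ dloCNF n :=
  mem_dloCNF_iff.2 (Or.inr ⟨s, t, hs, ht, hst, rfl⟩)

/-- `WORDER_n ⊆ DLO_n`. [Gryaznov–Ovcharov–Riazanov 2024, §3.1.3] [cite: GryaznovOvcharovRiazanov2024, §3.1.3] -/
theorem mem_dloCNF_of_mem_worderClauses {n : ℕ} {c : Clause ℕ} (hc : c ∈ worderClauses n) :
    c ∈ dloCNF n :=
  mem_dloCNF_iff.2 (Or.inl hc)

/-- A density clause holds iff `x_{st}` is false or some witness variable `z_{skt}` is true.
[Gryaznov–Ovcharov–Riazanov 2024, §3.1.3] [cite: GryaznovOvcharovRiazanov2024, §3.1.3] -/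
theorem eval_densityClause_iff {n s t : ℕ} {σ : ℕ → Bool} :
    Clause.eval σ (densityClause n s t) = true ↔
      σ (ordVar n s t) = false ∨ ∃ k, k < n ∧ k ≠ s ∧ k ≠ t ∧ σ (zVar n (s, k, t)) = true := by
  simp only [Clause.eval, densityClause, List.any_cons, List.any_eq_true, List.mem_map,
    List.mem_filter, List.mem_range, decide_eq_true_eq, Literal.eval, beq_iff_eq, Bool.or_eq_true]
  constructor
  · rintro (h | ⟨_, ⟨k, ⟨hk, hks, hkt⟩, rfl⟩, h⟩)
    · exact Or.inl h
    · exact Or.inr ⟨k, hk, hks, hkt, h⟩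
  · rintro (h | ⟨k, hk, hks, hkt, h⟩)
    · exact Or.inl h
    · exact Or.inr ⟨_, ⟨k, ⟨hk, hks, hkt⟩, rfl⟩, h⟩

/-! ### Proper assignments -/

/-- **`WORDER_n`-proper = `ORDER_n`-proper + witness semantics.** [Gryaznov–Ovcharov–Riazanov 2024,
§3.1.3] [cite: GryaznovOvcharovRiazanov2024, §3.1.3] -/
theorem isFProper_worderClauses_iff {n : ℕ} {σ : ℕ → Bool} :
    IsFProper (worderClauses n) σ ↔ IsFProper (linOrderClauses n) σ ∧
      ∀ τ ∈ distinctTriples n, σ (zVar n τ) = true →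
        σ (ordVar n τ.1 τ.2.1) = true ∧ σ (ordVar n τ.2.1 τ.2.2) = true := by
  constructor
  · intro h
    refine ⟨fun c hc => h c (mem_worderClauses_of_mem_linOrderClauses hc), fun τ hτ hz => ?_⟩
    have h1 := h _ (mem_worderClauses_iff.2 (Or.inr ⟨τ, hτ, Or.inl rfl⟩))
    have h2 := h _ (mem_worderClauses_iff.2 (Or.inr ⟨τ, hτ, Or.inr rfl⟩))
    revert h1 h2
    cases ha : σ (ordVar n τ.1 τ.2.1) <;> cases hb : σ (ordVar n τ.2.1 τ.2.2) <;>
      simp [Clause.eval, Literal.eval, hz, ha, hb]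
  · rintro ⟨hord, hwit⟩ c hc
    rcases mem_worderClauses_iff.1 hc with hc | ⟨τ, hτ, rfl | rfl⟩
    · exact hord c hc
    · cases hz : σ (zVar n τ)
      · simp [Clause.eval, Literal.eval, hz]
      · simp [Clause.eval, Literal.eval, hz, (hwit τ hτ hz).1]
    · cases hz : σ (zVar n τ)
      · simp [Clause.eval, Literal.eval, hz]
      · simp [Clause.eval, Literal.eval, hz, (hwit τ hτ hz).2]

/-- The WITNESS SET of an assignment: the triples `(i, k, j)` of pairwise distinct elements of `[n]`
with `z_{ikj} = 1`. [Gryaznov–Ovcharov–Riazanov 2024, §3.1.3] [cite: GryaznovOvcharovRiazanov2024, §3.1.3] -/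
def witSet (n : ℕ) (σ : ℕ → Bool) : Finset (ℕ × ℕ × ℕ) :=
  (distinctTriples n).toFinset.filter fun τ => σ (zVar n τ) = true

/-- Membership in the witness set. [folklore] -/
theorem mem_witSet_iff {n : ℕ} {σ : ℕ → Bool} {τ : ℕ × ℕ × ℕ} :
    τ ∈ witSet n σ ↔ τ ∈ distinctTriples n ∧ σ (zVar n τ) = true := by
  unfold witSet
  rw [Finset.mem_filter, List.mem_toFinset]

/-- **The witness set of a `WORDER_n`-proper assignment is proper** for its ranking: `z_{ikj} = 1`
forces `i ≺ k ≺ j`. [Gryaznov–Ovcharov–Riazanov 2024, §3.1.3] [cite: GryaznovOvcharovRiazanov2024, §3.1.3] -/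
theorem wProper_witSet {n : ℕ} {σ : ℕ → Bool} (hσ : IsFProper (worderClauses n) σ) :
    WProper (Finset.range n) (rankOf n σ) (witSet n σ) := by
  obtain ⟨hord, hwit⟩ := isFProper_worderClauses_iff.1 hσ
  intro τ hτ
  obtain ⟨hτd, hz⟩ := mem_witSet_iff.1 hτ
  obtain ⟨h1, h2, h3, h12, h13, h23⟩ := mem_distinctTriples.1 hτd
  obtain ⟨ha, hb⟩ := hwit τ hτd hz
  exact ⟨⟨Finset.mem_range.2 h1, Finset.mem_range.2 h2, Finset.mem_range.2 h3⟩,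
    (eq_true_iff_rankOf_lt hord h1 h2 h12).1 ha, (eq_true_iff_rankOf_lt hord h2 h3 h23).1 hb⟩

/-! ### Decoding `z`-variables -/

/-- The triple encoded by a `z`-variable index. [folklore] -/
def decodeTriple (n v : ℕ) : ℕ × ℕ × ℕ :=
  (((v - n * n) / n) / n, ((v - n * n) / n) % n, (v - n * n) % n)

/-- `v` is (the index of) a `z`-variable of `DLO_n`: it lies in `[n², n² + n³)` and decodes to a
triple of pairwise distinct elements. [folklore] -/
def IsZVar (n v : ℕ) : Prop :=
  n * n ≤ v ∧ v < n * n + n * n * n ∧ (decodeTriple n v).1 ≠ (decodeTriple n v).2.1 ∧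
    (decodeTriple n v).1 ≠ (decodeTriple n v).2.2 ∧ (decodeTriple n v).2.1 ≠ (decodeTriple n v).2.2

/-- Being a `z`-variable index is decidable (arithmetic). [folklore] -/
instance instDecidableIsZVar (n v : ℕ) : Decidable (IsZVar n v) := by
  unfold IsZVar; infer_instance

/-- Decoding a `z`-variable gives back its triple. [folklore] -/
theorem decodeTriple_zVar {n : ℕ} {τ : ℕ × ℕ × ℕ} (h1 : τ.1 < n) (h2 : τ.2.1 < n) (h3 : τ.2.2 < n) :
    decodeTriple n (zVar n τ) = τ := by
  obtain ⟨a, b, c⟩ := τ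
  simp only at h1 h2 h3
  unfold decodeTriple zVar
  simp only [Nat.add_sub_cancel_left]
  rw [ordVar_div h3, ordVar_mod h3, ordVar_div h2, ordVar_mod h2]

/-- `z`-variable indices lie in `[n², n² + n³)`. [folklore] -/
theorem zVar_bounds {n : ℕ} {τ : ℕ × ℕ × ℕ} (h1 : τ.1 < n) (h2 : τ.2.1 < n) (h3 : τ.2.2 < n) :
    n * n ≤ zVar n τ ∧ zVar n τ < n * n + n * n * n := by
  have hK : ordVar n τ.1 τ.2.1 < n * n := ordVar_lt h1 h2
  have h : ordVar n (ordVar n τ.1 τ.2.1) τ.2.2 < n * n * n := by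
    set K := ordVar n τ.1 τ.2.1
    unfold ordVar
    calc K * n + τ.2.2 < K * n + n := by omega
      _ = (K + 1) * n := by ring
      _ ≤ (n * n) * n := Nat.mul_le_mul_right n hK
  unfold zVar
  exact ⟨Nat.le_add_right _ _, by omega⟩

/-- The index of a witness triple is a `z`-variable. [folklore] -/
theorem isZVar_zVar {n : ℕ} {τ : ℕ × ℕ × ℕ} (hτ : τ ∈ distinctTriples n) : IsZVar n (zVar n τ) := by
  obtain ⟨h1, h2, h3, h12, h13, h23⟩ := mem_distinctTriples.1 hτ
  obtain ⟨hlo, hhi⟩ := zVar_bounds h1 h2 h3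
  refine ⟨hlo, hhi, ?_⟩
  rw [decodeTriple_zVar h1 h2 h3]
  exact ⟨h12, h13, h23⟩

/-- Encoding the decoded triple of a `z`-variable gives back the index, and the triple is a
distinct triple of `[n]`. [folklore] -/
theorem zVar_decodeTriple {n v : ℕ} (hv : IsZVar n v) :
    zVar n (decodeTriple n v) = v ∧ decodeTriple n v ∈ distinctTriples n := by
  obtain ⟨hlo, hhi, h12, h13, h23⟩ := hv
  have hn : 0 < n := Nat.pos_of_ne_zero fun h0 => by rw [h0] at hhi; simp at hhi
  set w := v - n * n with hw
  have hwlt : w < n * n * n := by omega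
  have hq : w / n < n * n := Nat.div_lt_of_lt_mul (by rw [Nat.mul_assoc] at hwlt; linarith [hwlt])
  have hqq : w / n / n < n := Nat.div_lt_of_lt_mul hq
  have key : zVar n (decodeTriple n v) = v := by
    unfold zVar decodeTriple ordVar
    simp only
    rw [← hw]
    have e1 : w / n / n * n + w / n % n = w / n := Nat.div_add_mod' (w / n) n
    have e2 : w / n * n + w % n = w := Nat.div_add_mod' w n
    rw [e1, e2]; omega
  refine ⟨key, mem_distinctTriples.2 ⟨hqq, Nat.mod_lt _ hn, Nat.mod_lt _ hn, h12, h13, h23⟩⟩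

/-- A `z`-variable is not an `x`-variable index. [folklore] -/
theorem not_isOrdVar_of_isZVar {n v : ℕ} (hv : IsZVar n v) : ¬ (v < n * n ∧ v / n ≠ v % n) :=
  fun h => absurd hv.1 (not_le.2 h.1)

/-! ### The assignment of a ranking with witnesses -/

/-- Set the `z`-variables from the witness set `W` (junk and `x`-indices from `σ`). [Gryaznov–Ovcharov–
Riazanov 2024, Prop. 1 (proof: "`τ(z_{ikj}) = 1`" / "sets every `z_{ikj}` to zero")]
[cite: GryaznovOvcharovRiazanov2024, Proposition 1] -/
def zAssign (n : ℕ) (W : Finset (ℕ × ℕ × ℕ)) (σ : ℕ → Bool) : ℕ → Bool := fun v =>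
  if IsZVar n v then decide (decodeTriple n v ∈ W) else σ v

/-- The assignment of a RANKING `ρ` WITH WITNESS SET `W`: `x_{kl} := [ρ k < ρ l]`,
`z_{ikj} := [(i,k,j) ∈ W]`, `σ` elsewhere. [Gryaznov–Ovcharov–Riazanov 2024, Prop. 1 (proof)]
[cite: GryaznovOvcharovRiazanov2024, Proposition 1] -/
def dloAssign (n : ℕ) (ρ : ℕ → ℕ) (W : Finset (ℕ × ℕ × ℕ)) (σ : ℕ → Bool) : ℕ → Bool :=
  rankAssign n ρ (zAssign n W σ)

/-- The assignment of `(ρ, W)` on `x_{kl}`. [folklore] -/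
theorem dloAssign_ordVar {n : ℕ} (ρ : ℕ → ℕ) (W : Finset (ℕ × ℕ × ℕ)) (σ : ℕ → Bool) {k l : ℕ}
    (hk : k < n) (hl : l < n) (hkl : k ≠ l) :
    dloAssign n ρ W σ (ordVar n k l) = decide (ρ k < ρ l) :=
  rankAssign_ordVar ρ _ hk hl hkl

/-- Off the `x`-variables the assignment of `(ρ, W)` is `zAssign`. [folklore] -/
theorem dloAssign_of_not_isOrdVar {n : ℕ} (ρ : ℕ → ℕ) (W : Finset (ℕ × ℕ × ℕ)) (σ : ℕ → Bool)
    {v : ℕ} (hv : ¬ (v < n * n ∧ v / n ≠ v % n)) : dloAssign n ρ W σ v = zAssign n W σ v := by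
  unfold dloAssign rankAssign
  rw [if_neg hv]

/-- The assignment of `(ρ, W)` on `z_{ikj}`. [folklore] -/
theorem dloAssign_zVar {n : ℕ} (ρ : ℕ → ℕ) (W : Finset (ℕ × ℕ × ℕ)) (σ : ℕ → Bool)
    {τ : ℕ × ℕ × ℕ} (hτ : τ ∈ distinctTriples n) : dloAssign n ρ W σ (zVar n τ) = decide (τ ∈ W) := by
  have hz := isZVar_zVar hτ
  rw [dloAssign_of_not_isOrdVar ρ W σ (not_isOrdVar_of_isZVar hz)]
  unfold zAssign
  obtain ⟨h1, h2, h3, -⟩ := mem_distinctTriples.1 hτ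
  rw [if_pos hz, decodeTriple_zVar h1 h2 h3]

/-- The assignment of `(ρ, W)` on junk indices. [folklore] -/
theorem dloAssign_junk {n : ℕ} (ρ : ℕ → ℕ) (W : Finset (ℕ × ℕ × ℕ)) (σ : ℕ → Bool) {v : ℕ}
    (hx : ¬ (v < n * n ∧ v / n ≠ v % n)) (hz : ¬ IsZVar n v) : dloAssign n ρ W σ v = σ v := by
  rw [dloAssign_of_not_isOrdVar ρ W σ hx]
  unfold zAssign
  rw [if_neg hz]

/-- **Rankings with proper witness sets are `WORDER_n`-proper.** [Gryaznov–Ovcharov–Riazanov 2024,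
Prop. 1 (proof: "encode linear orders" / witnesses)] [cite: GryaznovOvcharovRiazanov2024, Proposition 1] -/
theorem isFProper_dloAssign {n : ℕ} {ρ : ℕ → ℕ} {W : Finset (ℕ × ℕ × ℕ)}
    (hρ : Set.InjOn ρ (Finset.range n : Finset ℕ)) (hW : WProper (Finset.range n) ρ W)
    (σ : ℕ → Bool) : IsFProper (worderClauses n) (dloAssign n ρ W σ) := by
  rw [isFProper_worderClauses_iff]
  refine ⟨isFProper_rankAssign hρ _, fun τ hτ hz => ?_⟩
  obtain ⟨h1, h2, h3, h12, -, h23⟩ := mem_distinctTriples.1 hτ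
  rw [dloAssign_zVar ρ W σ hτ, decide_eq_true_eq] at hz
  obtain ⟨-, ha, hb⟩ := hW τ hz
  rw [dloAssign_ordVar ρ W σ h1 h2 h12, dloAssign_ordVar ρ W σ h2 h3 h23]
  simp [ha, hb]

/-- A proper assignment IS the assignment of its own ranking and witness set. [Gryaznov–Ovcharov–
Riazanov 2024, Prop. 1 (proof)] [cite: GryaznovOvcharovRiazanov2024, Proposition 1] -/
theorem dloAssign_self {n : ℕ} {σ : ℕ → Bool} (hσ : IsFProper (worderClauses n) σ) :
    dloAssign n (rankOf n σ) (witSet n σ) σ = σ := by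
  have hz : zAssign n (witSet n σ) σ = σ := by
    funext v
    unfold zAssign
    split_ifs with hv
    · obtain ⟨henc, hmem⟩ := zVar_decodeTriple hv
      have : (decodeTriple n v ∈ witSet n σ) ↔ σ v = true := by
        rw [mem_witSet_iff, henc]
        exact ⟨fun h => h.2, fun h => ⟨hmem, h⟩⟩
      by_cases h : σ v = true
      · rw [h]; exact decide_eq_true (this.2 h)
      · rw [Bool.not_eq_true] at h
        rw [h]; exact decide_eq_false fun h' => by rw [this.1 h'] at h; exact Bool.noConfusion h
    · rfl
  unfold dloAssign
  rw [hz]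
  exact rankAssign_rankOf (isFProper_worderClauses_iff.1 hσ).1

/-- `WORDER_n`-proper assignments exist (the natural order, no witnesses). [Gryaznov–Ovcharov–
Riazanov 2024, §3.1.3] [cite: GryaznovOvcharovRiazanov2024, §3.1.3] -/
theorem exists_isFProper_worderClauses (n : ℕ) :
    ∃ σ : ℕ → Bool, IsFProper (worderClauses n) σ :=
  ⟨dloAssign n id ∅ fun _ => false,
    isFProper_dloAssign (fun _ _ _ _ h => h) (fun τ hτ => absurd hτ (Finset.notMem_empty τ)) _⟩

end Literature.Computability.MetaComplexity
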